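import Summits.CriticalPhenomena.SAWScalingLimit.Theses.SAWRestrictionRigidity
import Literature.Probability.RandomPlanarGeometry.SAWScalingLimitFamily
import Literature.Probability.RandomPlanarGeometry.ChordalRestrictionMarkov
import HarnessLib

/-!
# `stub_markovOfLimit` (crux `AxiomsOfLimit`, stmt-CriticalPhenomena-1370, line `registered` = `split`):
# the lead c2's audit of the child cut `markov_birth`, and a corrected sub-skeleton for the child `MarkovOfLimit`

Lead: prover-line-stmt-CriticalPhenomena-1370-c2-0 (2026-08-17). Companion memo: `Lines/split_markov_c2.md`.

This file is a CRUX WORKFILE (analysis + proposed child skeleton), not a `Theorems/` file. It is kernel-checked: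
§1 is `sorry`-free; in §3 the ONLY `sorry`s are the three proposed child stubs.

## §1  The discretised slit domain of `Lines/markov_birth.lean` is slit-blind (proved)

`markov_birth` (the strategist's sub-skeleton for the not-yet-filed child `MarkovOfLimit`) defines the kernel as the
scaling limit of `SAW.law (remainingDomain D past) δ a' b'`, i.e. of the critical SAW of the CANONICAL
DISCRETISATION `discreteDomainGraph (remainingDomain D past) δ` of the open slit domain `D ∖ past`. But the tree's
discretisation joins two neighbouring sites of `δℤ²` iff the closed segment between their mesh points lies in the
CLOSURE of the open set (`meshGraph_adj_iff`), and removing a closed set with empty interior (a slit: the range of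
a simple past) from an open set does not change the closure (`closure_diff_eq_closure`). Hence
`meshGraph (Ω ∖ K) δ = meshGraph Ω δ` (`meshGraph_diff_eq`): the discretised slit domain keeps EVERY edge of the
discretised domain that crosses the slit; it only loses the (generically: no) sites lying exactly on the slit
(`meshVertices_diff`). PRECEDENT IN THE TREE: `Literature/Probability/LatticeModels/PlanarIsingSlitDisc.lean` uses exactly
this coincidence (`meshGraph_eq_of_closure_eq`, `discreteDomainGraph_eq_of_closure_eq`; for the unit disc slit along a ray
of slope `√3` no site of any `δℤ²` lies on the slit, `SlitDisc.meshPoint_not_mem_slit`, so the slit disc and the disc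
have the SAME `discreteDomainGraph` at every mesh) to REFUTE a CHI one-point fact vendored without the Hausdorff
approximation hypothesis (`not_chi_halfplane_onePoint`). So `IsSlitLimitKernel Q` of `markov_birth` does not describe "the SAW in the slit graph"
(LSW04 §2.3) at all — its walks jump across the explored past — and its S1 `stub_slitLimitKernel`
(`∃ Q, IsSlitLimitKernel Q ∧ P.IsMarkovExtension Q`) is, for the conjectural SAW limit, morally FALSE (the future
would cross the past with positive probability, contradicting simplicity of `P`). The lattice object that IS
exact is the conditional law of the remaining walk given a lattice PREFIX (tree:
`…FKGToTraversalBound.ExcursionDomination.law_prefix_restrict`, Kemppainen–Smirnov 2017 Remark 2.8), §2 below.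

## §2  Corrected vocabulary: lattice prefixes and the conditional law of the future

`prefixEvent ω` (the cylinder of the walks extending the lattice prefix `ω`), `futureCurve k` (the polyline of the
walk after its first `k` steps), `futureLaw Ω δ a b ω` (the critical SAW law CONDITIONED on the cylinder, pushed to
the future polyline — `ProbabilityTheory.cond` + `Measure.map`, no new measure theory), `pastCurve`,
`IsPastApprox D a b p ω` (lattice prefixes, eventually self-avoiding and charged, whose polylines converge to the
continuum past `p` in `CurveClass ℂ`), `admissiblePast D` (the pasts a simple boundary-avoiding chord can have:
the trivial past, or a simple arc from `a` in `D̄` meeting `∂D` at most in `{a, b}`), `GoodConfig R t b` (marked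
slit configurations `(remainingDomain D p; p.target, D.pt 1)` of approximable admissible pasts), and
`IsFutureKernel Φ`: `Φ (R; t, b)` is the limit of the conditional future laws along EVERY past approximation of
every approximable admissible configuration (this universality in the approximation IS the "tip stability" the
crux's why-might-fail names), and `0` off the good configurations (so the restriction-kernel clause is `0 = 0`
there, cf. `kernelClause_of_eq_zero` of `Lines/split_markovShape.lean`).

## §3  Proposed child skeleton (3 stubs, composition proved): `MarkovOfLimitStmt` ⇐ S1a ∧ S1b ∧ S2'

* S1a `stub_futureKernelExists` (HARDEST, XL; `P`-free): `∃ Φ, IsFutureKernel Φ` — tip-stable conditional-future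
  scaling limits of the critical SAW exist.
* S1b `stub_markovPassage` (L–XL): for a chordal full limit `P` carried by simple boundary-avoiding curves, every
  future kernel is a domain-Markov extension of `P` (`initial` = `(lim)` + uniqueness of weak limits for the trivial
  prefix; `domain` is automatic for kernels of slit shape; `markov` = the exact lattice identity
  `law_prefix_restrict` passed to the limit at the first hitting of each closed `F` — joint convergence of
  (past, future) needs a.s. continuity of `stopAt F` under `P D` (no grazing), and the all-`F` clause follows from
  a countable family `F_n ↓ F` by the Lévy upward theorem PROVIDED the kernel is continuous along increasing pasts,
  which is exactly what "every past approximation" in `IsFutureKernel` supplies; see the memo §2).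
* S2' `stub_kernelRestrictionPassage` (L–XL): for a chordal full limit `P` with restriction, every future kernel
  satisfies the restriction-kernel clause (exact on the lattice: the conditioned future of the slit graph,
  conditioned to stay in `D̄'`, is the critical chord of `D'_δ` up to boundary bookkeeping; passage = the slit
  analogue of the shared crux `RestrictionOfLimit`, stmt-0773; `0 = 0` off the good configurations).
`markovOfLimitStmt_of : S1a → S1b → S2' → MarkovOfLimitStmt` (the registered stub's statement, verbatim) is proved.

References: G. F. Lawler, O. Schramm, W. Werner, *On the scaling limit of planar self-avoiding walk* (2004),
arXiv:math/0204277, §2.3, §3.4.5; A. Kemppainen, S. Smirnov, *Random curves, scaling limits and Loewner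
evolutions*, Ann. Probab. 45 (2017), Remark 2.8; W. Werner, *Lectures on two-dimensional critical percolation*
(2007), §3.2 (2). All [folklore] at the level of statements.
-/

noncomputable section

open MeasureTheory Filter Topology Set
open Literature.Probability.LatticeModels Literature.Probability.Percolation
open Literature.Probability.RandomPlanarGeometry

namespace Summit.CriticalPhenomena.SAWScalingLimit.Cruxes.AxiomsOfLimit.MarkovC2

/-! ### §1 Slit-blindness of the canonical discretisation of a slit domain -/

/-- Removing a set with empty interior from an open set does not change the closure. [folklore] -/
theorem closure_diff_eq_closure {Ω K : Set ℂ} (hΩ : IsOpen Ω) (hK : interior K = ∅) :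
    closure (Ω \ K) = closure Ω := by
  refine (closure_mono Set.sdiff_subset).antisymm ?_
  have hd : Dense Kᶜ := interior_eq_empty_iff_dense_compl.1 hK
  have h : Ω ⊆ closure (Ω \ K) := by
    rw [sdiff_eq]
    exact hd.open_subset_closure_inter hΩ
  simpa only [closure_closure] using closure_mono h

/-- **Slit-blindness (edges).** The mesh graph of `Ω ∖ K` IS the mesh graph of `Ω` whenever `Ω` is open and
`K` has empty interior (e.g. `K` = the range of a simple explored past): an edge of `δℤ²` is kept iff its
closed segment lies in `closure (Ω ∖ K) = closure Ω`, a condition that does not see `K`; in particular every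
edge of `Ω_δ` CROSSING the slit `K` survives. [folklore] -/
theorem meshGraph_diff_eq {Ω K : Set ℂ} (hΩ : IsOpen Ω) (hK : interior K = ∅) (δ : ℝ) :
    meshGraph (Ω \ K) δ = meshGraph Ω δ := by
  ext x y
  rw [meshGraph_adj_iff, meshGraph_adj_iff, closure_diff_eq_closure hΩ hK]

/-- **Slit-blindness (vertices).** The mesh vertices of `Ω ∖ K` are those of `Ω` minus the sites whose mesh
point lies exactly ON `K` — for a slit and a generic mesh, none. [folklore] -/
theorem meshVertices_diff (Ω K : Set ℂ) (δ : ℝ) :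
    meshVertices (Ω \ K) δ = meshVertices Ω δ \ {x | meshPoint δ x ∈ K} := by
  ext x
  simp [meshVertices]

/-- Slit-blindness for the remaining domain of `markov_birth`: when the remaining domain is the whole slit
domain `D ∖ p.range` (both sides of the past see `b`, the generic case) and the past has empty interior
(e.g. a simple arc), the mesh graph of `remainingDomain D p` is the mesh graph of `D` itself. [folklore] -/
theorem meshGraph_remainingDomain_eq (D : DobrushinDomain) (p : CurveClass ℂ)
    (hR : remainingDomain D p = D.carrier \ p.range) (hp : interior p.range = ∅) (δ : ℝ) :
    meshGraph (remainingDomain D p) δ = meshGraph D.carrier δ := by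
  rw [hR, meshGraph_diff_eq D.isOpen hp]

/-- An edge of `δℤ²` whose closed mesh segment lies in `Ω̄` is an edge of the mesh graph of the slit domain
`Ω ∖ K` — even if the segment crosses `K`. [folklore] -/
theorem meshGraph_diff_adj {Ω K : Set ℂ} (hΩ : IsOpen Ω) (hK : interior K = ∅) {δ : ℝ} {x y : Site 2}
    (hxy : (zdGraph 2).Adj x y) (hseg : segment ℝ (meshPoint δ x) (meshPoint δ y) ⊆ closure Ω) :
    (meshGraph (Ω \ K) δ).Adj x y := by
  rw [meshGraph_diff_eq hΩ hK]
  exact meshGraph_adj_iff.2 ⟨hxy, hseg⟩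

/-! ### §2 Lattice prefixes and the conditional law of the future -/

section Lattice

variable {Ω : Set ℂ} {δ : ℝ} {a b : Site 2}

/-- A lattice past: a walk of `Ω_δ` from `a` to some tip `t` (self-avoidance is asked eventually, in
`IsPastApprox`). [cite: LawlerSchrammWerner2004SAW, §2.3] -/
abbrev LatticePast (Ω : Set ℂ) (δ : ℝ) (a : Site 2) : Type :=
  Σ t : Site 2, (discreteDomainGraph Ω δ).Walk a t

/-- **The cylinder of a lattice prefix**: the chords `γ : a → b` of `Ω_δ` whose first `|ω| + 1` vertices are the
vertices of `ω` (i.e. `γ = ω · (future)`). [cite: LawlerSchrammWerner2004SAW, §2.3] -/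
def prefixEvent (ω : LatticePast Ω δ a) : Set (SAW.DomainSAW Ω δ a b) :=
  {γ | γ.walk.support.take (ω.2.length + 1) = ω.2.support}

/-- **The future of a chord after its first `k` steps**, as a curve modulo reparametrisation (the polyline of
`γ.walk.drop k`, from the `k`-th vertex to `b`). [cite: LawlerSchrammWerner2004SAW, §2.3] -/
def futureCurve (k : ℕ) (γ : SAW.DomainSAW Ω δ a b) : CurveClass ℂ :=
  CurveClass.mk ⟨(γ.walk.drop k).toCurve (meshPoint δ)⟩

/-- **The conditional law of the future given the lattice past `ω`**: the critical SAW law `SAW.law Ω δ a b`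
conditioned on the cylinder `prefixEvent ω` (`ProbabilityTheory.cond`; the zero measure if the cylinder is not
charged), pushed forward to the future polyline. Exactly — LSW04 §2.3, tree `law_prefix_restrict` — this is the
critical chord law of the SLIT GRAPH `Ω_δ ∖ (ω ∖ tip)` from the tip to `b`.
[cite: LawlerSchrammWerner2004SAW, §2.3] -/
def futureLaw (Ω : Set ℂ) (δ : ℝ) (a b : Site 2) (ω : LatticePast Ω δ a) : Measure (CurveClass ℂ) :=
  (ProbabilityTheory.cond (SAW.law Ω δ a b) (prefixEvent ω)).map (futureCurve ω.2.length)

/-- The lattice past as a curve modulo reparametrisation (its mesh polyline). [folklore] -/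
def pastCurve (δ : ℝ) (ω : LatticePast Ω δ a) : CurveClass ℂ :=
  CurveClass.mk ⟨ω.2.toCurve (meshPoint δ)⟩

end Lattice

/-- **Lattice approximation of a continuum past.** Along `δ → 0⁺` the lattice pasts `ω δ` (walks of `D_δ` from
`a_δ`) are eventually self-avoiding and charged by the critical chord law (some SAW from `a_δ` to `b_δ` extends
them), and their polylines converge to `p` in `CurveClass ℂ`. [folklore] -/
structure IsPastApprox (D : DobrushinDomain) (a b : ℝ → Site 2) (p : CurveClass ℂ)
    (ω : ∀ δ : ℝ, LatticePast D.carrier δ (a δ)) : Prop where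
  /-- eventually the prefix is self-avoiding -/
  isPath : ∀ᶠ δ in 𝓝[>] (0 : ℝ), (ω δ).2.IsPath
  /-- eventually the cylinder of the prefix has positive critical mass -/
  charged : ∀ᶠ δ in 𝓝[>] (0 : ℝ),
    SAW.law D.carrier δ (a δ) (b δ) (prefixEvent (b := b δ) (ω δ)) ≠ 0
  /-- the polylines of the prefixes converge to `p` -/
  tendsto : Tendsto (fun δ => pastCurve δ (ω δ)) (𝓝[>] (0 : ℝ)) (𝓝 p)

/-- **Admissible pasts** of the Dobrushin domain `(D; a, b)`: the pasts `stopAt F γ` of a SIMPLE chord `γ` from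
`a` to `b` in `D̄` meeting `∂D` only at `a, b` — the trivial past (constant curve at `a`) or a simple arc from
`a` in `D̄` meeting `∂D` at most in `{a, b}`. [folklore] -/
def admissiblePast (D : DobrushinDomain) : Set (CurveClass ℂ) :=
  {p | p.source = D.pt 0 ∧ p.range ⊆ closure D.carrier ∧ p.range ∩ frontier D.carrier ⊆ {D.pt 0, D.pt 1} ∧
    (p ∈ CurveClass.simple ∨ p = CurveClass.mk (Curve.const (D.pt 0)))}

/-- **Good marked slit configurations** `(R; t, b)`: those of the form
`(remainingDomain D p; p.target, D.pt 1)` for an admissible past `p` of `D` that has a lattice past approximation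
along some endpoint approximation of `D`. [folklore] -/
def GoodConfig (R : Set ℂ) (t b : ℂ) : Prop :=
  ∃ (D : DobrushinDomain) (a' b' : ℝ → Site 2) (p : CurveClass ℂ) (ω : ∀ δ : ℝ, LatticePast D.carrier δ (a' δ)),
    SAW.IsEndpointApprox D a' b' ∧ p ∈ admissiblePast D ∧ IsPastApprox D a' b' p ω ∧
      remainingDomain D p = R ∧ p.target = t ∧ D.pt 1 = b

/-- The kernel of slit shape attached to `Φ (R; t, b)`. [folklore] -/
def kernelOf (Φ : Set ℂ → ℂ → ℂ → Measure (CurveClass ℂ)) :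
    DobrushinDomain → CurveClass ℂ → Measure (CurveClass ℂ) :=
  fun D p => Φ (remainingDomain D p) p.target (D.pt 1)

/-- **Future kernel of the critical SAW** (`Φ (R; t, b)` = law of the future in the marked slit domain):
(i) along EVERY endpoint approximation of every Dobrushin domain, every admissible past `p` and EVERY lattice
past approximation `ω δ → p`, the conditional future laws `futureLaw D δ a_δ b_δ (ω δ)` converge weakly to
`Φ (remainingDomain D p; p.target, b)` ("tip stability" is the universality in `ω`); (ii) `Φ = 0` off the good
configurations. [cite: LawlerSchrammWerner2004SAW, §2.3] -/
def IsFutureKernel (Φ : Set ℂ → ℂ → ℂ → Measure (CurveClass ℂ)) : Prop :=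
  (∀ (D : DobrushinDomain) (a b : ℝ → Site 2), SAW.IsEndpointApprox D a b →
      ∀ p ∈ admissiblePast D, ∀ ω : ∀ δ : ℝ, LatticePast D.carrier δ (a δ), IsPastApprox D a b p ω →
        TendstoLaw (fun (_ : ℝ) (η : CurveClass ℂ) => η) (fun δ => futureLaw D.carrier δ (a δ) (b δ) (ω δ)) id
          (kernelOf Φ D p)) ∧
    ∀ (R : Set ℂ) (t b : ℂ), ¬ GoodConfig R t b → Φ R t b = 0

/-! ### §3 The proposed child skeleton: three stubs and the proved composition -/

/-- The `(lim)` hypothesis of the crux, abbreviated (literally the binder block of `AxiomsOfLimit`). -/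
abbrev Lim (P : ChordalFamily) : Prop :=
  ∀ (D : Literature.Probability.RandomPlanarGeometry.DobrushinDomain) (a b : ℝ → Literature.Probability.LatticeModels.Site 2), Literature.Probability.RandomPlanarGeometry.SAW.IsEndpointApprox D a b → Literature.Probability.RandomPlanarGeometry.TendstoLaw (fun δ (γ : Literature.Probability.RandomPlanarGeometry.SAW.DomainSAW D.carrier δ (a δ) (b δ)) => γ.curve) (fun δ => Literature.Probability.RandomPlanarGeometry.SAW.law D.carrier δ (a δ) (b δ)) id (P D)

/-- Simplicity and boundary avoidance of the family, abbreviated (literally conjunct (vi)). -/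
abbrev SimpleBA (P : ChordalFamily) : Prop :=
  ∀ D : Literature.Probability.RandomPlanarGeometry.DobrushinDomain, ∀ᵐ γ ∂(P D), γ ∈ Literature.Probability.RandomPlanarGeometry.CurveClass.simple ∧ γ.range ∩ frontier D.carrier ⊆ {D.pt 0, D.pt 1}

/-- The restriction-kernel clause for a kernel `Q`, abbreviated (literally the clause of the crux;
`= P.IsRestrictionKernel Q`, `Iff.rfl`). -/
abbrev KernelClause (P : ChordalFamily)
    (Q : DobrushinDomain → CurveClass ℂ → Measure (CurveClass ℂ)) : Prop :=
  ∀ (D : Literature.Probability.RandomPlanarGeometry.DobrushinDomain) (p : Literature.Probability.RandomPlanarGeometry.CurveClass ℂ) (D' : Literature.Probability.RandomPlanarGeometry.DobrushinDomain), D'.carrier ⊆ Literature.Probability.RandomPlanarGeometry.remainingDomain D p → D'.pt 0 = p.target → D'.pt 1 = D.pt 1 → ∀ T : Set (Literature.Probability.RandomPlanarGeometry.CurveClass ℂ), MeasurableSet T → P D' T * Q D p (Literature.Probability.RandomPlanarGeometry.CurveClass.rangeSubset (closure D'.carrier)) = Q D p (T ∩ Literature.Probability.RandomPlanarGeometry.CurveClass.rangeSubset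 (closure D'.carrier))

/-- **S1a (hardest, XL, `P`-free) — tip-stable conditional-future scaling limits of the critical SAW exist.**
[cite: LawlerSchrammWerner2004SAW, §2.3] -/
theorem stub_futureKernelExists : ∃ Φ : Set ℂ → ℂ → ℂ → Measure (CurveClass ℂ), IsFutureKernel Φ := by
  sorry

/-- **S1b (L–XL) — Markov passage.** For a chordal full scaling limit carried by simple boundary-avoiding
curves, every future kernel of the critical SAW is a domain-Markov extension of it.
[cite: LawlerSchrammWerner2004SAW, §2.3] -/
theorem stub_markovPassage :
    ∀ P : ChordalFamily, P.IsChordal → Lim P → SimpleBA P →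
      ∀ Φ : Set ℂ → ℂ → ℂ → Measure (CurveClass ℂ), IsFutureKernel Φ → P.IsMarkovExtension (kernelOf Φ) := by
  sorry

/-- **S2' (L–XL) — restriction passage in slit domains (the restriction-kernel clause).** For a chordal full
scaling limit with the restriction property, every future kernel of the critical SAW satisfies the
restriction-kernel clause (`0 = 0` off the good configurations). [cite: LawlerSchrammWerner2004SAW, §3.4.5] -/
theorem stub_kernelRestrictionPassage :
    ∀ P : ChordalFamily, P.IsChordal → Lim P → P.IsRestriction → SimpleBA P →
      ∀ Φ : Set ℂ → ℂ → ℂ → Measure (CurveClass ℂ), IsFutureKernel Φ → KernelClause P (kernelOf Φ) := by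
  sorry

/-- The registered stub's statement (`stub_markovOfLimit` of `Lines/split.lean`, = the split child
`MarkovOfLimit`), verbatim. -/
def MarkovOfLimitStmt : Prop :=
  ∀ P : Literature.Probability.RandomPlanarGeometry.ChordalFamily, P.IsChordal → (∀ (D : Literature.Probability.RandomPlanarGeometry.DobrushinDomain) (a b : ℝ → Literature.Probability.LatticeModels.Site 2), Literature.Probability.RandomPlanarGeometry.SAW.IsEndpointApprox D a b → Literature.Probability.RandomPlanarGeometry.TendstoLaw (fun δ (γ : Literature.Probability.RandomPlanarGeometry.SAW.DomainSAW D.carrier δ (a δ) (b δ)) => γ.curve) (fun δ => Literature.Probability.RandomPlanarGeometry.SAW.law D.carrier δ (a δ) (b δ)) id (P D)) → P.IsRestriction → (∀ D : Literature.Probability.RandomPlanarGeometry.DobrushinDomain, ∀ᵐ γ ∂(P D), γ ∈ Literature.Probability.RandomPlanarGeometry.CurveClass.simple ∧ γ.range ∩ frontier D.carrier ⊆ {D.pt 0, D.pt 1}) → ∃ Q : Literature.Probability.RandomPlanarGeometry.DobrushinDomain → Literature.Probability.RandomPlanarGeometry.CurveClass ℂ → MeasureTheory.Measure (Literature.Probability.RandomPlanarGeometry.CurveClass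 ℂ), P.IsMarkovExtension Q ∧ ∀ (D : Literature.Probability.RandomPlanarGeometry.DobrushinDomain) (p : Literature.Probability.RandomPlanarGeometry.CurveClass ℂ) (D' : Literature.Probability.RandomPlanarGeometry.DobrushinDomain), D'.carrier ⊆ Literature.Probability.RandomPlanarGeometry.remainingDomain D p → D'.pt 0 = p.target → D'.pt 1 = D.pt 1 → ∀ T : Set (Literature.Probability.RandomPlanarGeometry.CurveClass ℂ), MeasurableSet T → P D' T * Q D p (Literature.Probability.RandomPlanarGeometry.CurveClass.rangeSubset (closure D'.carrier)) = Q D p (T ∩ Literature.Probability.RandomPlanarGeometry.CurveClass.rangeSubset (closure D'.carrier))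

/-- **Composition (no `sorry` of its own): S1a → S1b → S2' → `MarkovOfLimitStmt`.** Take the future kernel `Φ`
of S1a; `kernelOf Φ` is a Markov extension by S1b and satisfies the kernel clause by S2'. [folklore] -/
theorem markovOfLimitStmt_of
    (h1a : ∃ Φ : Set ℂ → ℂ → ℂ → Measure (CurveClass ℂ), IsFutureKernel Φ)
    (h1b : ∀ P : ChordalFamily, P.IsChordal → Lim P → SimpleBA P →
      ∀ Φ : Set ℂ → ℂ → ℂ → Measure (CurveClass ℂ), IsFutureKernel Φ → P.IsMarkovExtension (kernelOf Φ))
    (h2 : ∀ P : ChordalFamily, P.IsChordal → Lim P → P.IsRestriction → SimpleBA P →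
      ∀ Φ : Set ℂ → ℂ → ℂ → Measure (CurveClass ℂ), IsFutureKernel Φ → KernelClause P (kernelOf Φ)) :
    MarkovOfLimitStmt := by
  intro P hch hlim hr hs
  obtain ⟨Φ, hΦ⟩ := h1a
  exact ⟨kernelOf Φ, h1b P hch hlim hs Φ hΦ, h2 P hch hlim hr hs Φ hΦ⟩

/-- Wiring check: the three stubs feed the composition as stated. -/
example : MarkovOfLimitStmt :=
  markovOfLimitStmt_of stub_futureKernelExists stub_markovPassage stub_kernelRestrictionPassage

/-- The composition also yields the tree's bundled form `P.IsRestrictionMarkov` for scaling-limit families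
(`SAW.IsScalingLimitFamily P = P.IsChordal ∧ (lim)`), given restriction and simplicity. [folklore] -/
theorem isRestrictionMarkov_of_stubs (h : MarkovOfLimitStmt) {P : ChordalFamily}
    (hP : SAW.IsScalingLimitFamily P) (hr : P.IsRestriction) (hs : SimpleBA P) : P.IsRestrictionMarkov := by
  obtain ⟨Q, hQ, hK⟩ := h P hP.1 hP.2 hr hs
  exact ⟨Q, hQ, hK⟩

end Summit.CriticalPhenomena.SAWScalingLimit.Cruxes.AxiomsOfLimit.MarkovC2

end
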